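import Literature.Analysis.FluidPDE.QuantitativeShellsOfRegularity
import Literature.Analysis.FluidPDE.LeiRenQuantitativeShells
import HarnessLib

/-!
# Lei–Ren–Tian 2025, Lemma 2.4 (quantitative shells of regularity): the second tree rendering follows from the canonical one

Topic `Literature/Analysis/FluidPDE` (family `ns`). Literature HYGIENE file (no new fact, net debt 0).

The printed lemma — Z. Lei, X. Ren, G. Tian, arXiv:2501.08976, Lemma 2.4 (p. 7), quoting Z. Lei, X. Ren, Adv. Math. 445
(2024), Thm 2 / Remark 8 / Prop 9 — was vendored TWICE within four minutes on 2026-08-28 (cite item wi-87109 served to two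
seats): the CANONICAL pair `LeiRen2024_quantitative_regular_shells` (round cylinders `Q(r)`) and
`LeiRen2024_quantitative_regular_shells_cyl` (flat cylinders `𝓠(r)`) of `QuantitativeShellsOfRegularity.lean` (p621185,
bound by route `AxisTwistDoor`), and the second rendering `leiRenTian_quantitative_shells_of_regularity` of
`LeiRenQuantitativeShells.lean` (p621411; both shapes through a `Bool`, the class unpackaged over `lrtCylinderOpens cyl 1`
with an extra `∫|v|³ < ∞`, strict bounds `< G^{CG}` with the real constant `G = lrtG cyl v p`, and WITHOUT the
"regular in the space–time closure" clause). This file proves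

* `leiRenTian_quantitative_shells_of_regularity_of_canonical :
    LeiRen2024_quantitative_regular_shells → LeiRen2024_quantitative_regular_shells_cyl →
      leiRenTian_quantitative_shells_of_regularity`,

so the three recorded `Prop`s for this one printed lemma carry ONE piece of debt (the canonical pair), and the two typings are
cross-checked against each other in the kernel. Ingredients (`namespace LeiRenTianBridge`): the cylinders and shells
coincide as sets / `Opens` (`lrtCylinder false r = parabolicCylinder r 0`, `lrtCylinder true r = SereginSverak2009.parCyl 0 r`,
hence the shells); the unpackaged class repackages into `IsSuitableWeakSolutionInBall 1 0` resp.
`LeiRen2024.IsSuitableWeakSolutionInCyl 1` (`p ∈ L^{3/2}` from `∫|p|^{3/2} < ∞` and the local integrability of `p` inside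
`IsSuitableWeakSolutionOn`); `∫(|v|³ + |p|^{3/2}) + 2 ≤ ofReal (lrtG cyl v p)` (finite integral); and the universal constant
`C := max M M' + 1` turns `≤ G^{MG}` into `< G^{CG}` and `G^{−MG} < δ` into `G^{−CG} < δ` since `G ≥ 2`.

The converse implication does NOT hold as typed (the second rendering drops the closure-regularity clause and assumes more),
which is why the canonical pair is the one consumers bind (director-ns #197 (2), 2026-08-28).

## References

* Z. Lei, X. Ren, G. Tian, *A geometric characterization of potential Navier–Stokes singularities*, arXiv:2501.08976 (2025),
  §2 (p. 6), Lemma 2.4 (p. 7). [cite: LeiRenTian2025, Lemma 2.4 (arXiv p.7)]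
* Z. Lei, X. Ren, *Quantitative partial regularity of the Navier–Stokes equations and applications*, Adv. Math. 445 (2024)
  109654 = arXiv:2210.01783, Thm 2, Remark 8, Prop 9 (p. 5). [cite: LeiRen2024QuantitativePartialRegularity, Thm 2 (arXiv p.5)]
-/

noncomputable section

open MeasureTheory Set Function Metric TopologicalSpace
open scoped ENNReal NNReal

namespace Literature.Analysis.FluidPDE

namespace LeiRenTianBridge

/-! ### The two systems of cylinders coincide -/

/-- `Q(r)` of the second rendering is the canonical `parabolicCylinder r 0`. [cite: LeiRenTian2025, §2 (arXiv p.6)] -/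
theorem lrtCylinder_false_eq (r : ℝ) :
    lrtCylinder false r = parabolicCylinder r (0 : ℝ × EuclideanSpace ℝ (Fin 3)) :=
  lrtCylinder_false r

/-- `ℬ(r)` of the second rendering is Seregin–Šverák's `𝒞(0, r)`. [cite: LeiRenTian2025, §2 (arXiv p.6)] -/
theorem lrtBall_true_eq (r : ℝ) : lrtBall true r = SereginSverak2009.spaceCyl 0 r := by
  ext x
  simp [SereginSverak2009.mem_spaceCyl]

/-- `𝒬(r)` of the second rendering is Seregin–Šverák's `Q(0, r)`. [cite: LeiRenTian2025, §2 (arXiv p.6)] -/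
theorem lrtCylinder_true_eq (r : ℝ) : lrtCylinder true r = SereginSverak2009.parCyl 0 r := by
  ext z
  simp [mem_lrtCylinder_iff]

/-- The same, as open sets (round). [cite: LeiRenTian2025, §2 (arXiv p.6)] -/
theorem lrtCylinderOpens_false_eq (r : ℝ) :
    lrtCylinderOpens false r = parabolicCylinderOpens r (0 : ℝ × EuclideanSpace ℝ (Fin 3)) :=
  Opens.ext (lrtCylinder_false_eq r)

/-- The same, as open sets (flat). [cite: LeiRenTian2025, §2 (arXiv p.6)] -/
theorem lrtCylinderOpens_true_eq (r : ℝ) :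
    lrtCylinderOpens true r = SereginSverak2009.parCylOpens 0 r :=
  Opens.ext (lrtCylinder_true_eq r)

/-- The open shells coincide (round). [cite: LeiRenTian2025, Lemma 2.4 (arXiv p.7)] -/
theorem lrtShell_false_eq (a δ : ℝ) :
    lrtShell false a δ = parabolicCylinder (a + δ) (0 : ℝ × EuclideanSpace ℝ (Fin 3)) \
      closure (parabolicCylinder (a - δ) (0 : ℝ × EuclideanSpace ℝ (Fin 3))) := by
  rw [lrtShell, lrtCylinder_false_eq, lrtCylinder_false_eq]

/-- The open shells coincide (flat). [cite: LeiRenTian2025, Lemma 2.4 (arXiv p.7)] -/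
theorem lrtShell_true_eq (a δ : ℝ) :
    lrtShell true a δ = SereginSverak2009.parCyl 0 (a + δ) \ closure (SereginSverak2009.parCyl 0 (a - δ)) := by
  rw [lrtShell, lrtCylinder_true_eq, lrtCylinder_true_eq]

/-! ### Repackaging the class -/

/-- `p ∈ L^{3/2}(Q)` from `∫_Q |p|^{3/2} < ∞` and local integrability on the open set `Q`. [folklore] -/
private theorem memLp_of_lintegral {Q : Set (ℝ × EuclideanSpace ℝ (Fin 3))}
    {p : ℝ → EuclideanSpace ℝ (Fin 3) → ℝ} (hloc : LocallyIntegrableOn (uncurry p) Q volume)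
    (hfin : ∫⁻ z in Q, ‖p z.1 z.2‖ₑ ^ (3 / 2 : ℝ) < ∞) :
    MemLp (uncurry p) (3 / 2) (volume.restrict Q) := by
  refine ⟨hloc.aestronglyMeasurable, ?_⟩
  have h32 : ((3 / 2 : ℝ≥0∞)).toReal = (3 / 2 : ℝ) := by
    rw [ENNReal.toReal_div]; norm_num
  rw [eLpNorm_lt_top_iff_lintegral_rpow_enorm_lt_top (by norm_num) (by finiteness), h32]
  exact hfin

variable {v : ℝ → EuclideanSpace ℝ (Fin 3) → EuclideanSpace ℝ (Fin 3)} {p : ℝ → EuclideanSpace ℝ (Fin 3) → ℝ}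
  {H : ℝ → EuclideanSpace ℝ (Fin 3) → EuclideanSpace ℝ (Fin 3) →L[ℝ] EuclideanSpace ℝ (Fin 3)}

/-- The hypotheses of the second rendering (round case) give the canonical class
`IsSuitableWeakSolutionInBall 1 0`. [cite: LeiRenTian2025, §2.1 (2.3)–(2.4) (arXiv p.6)] -/
theorem isSuitableWeakSolutionInBall_of
    (hsw : IsSuitableWeakSolutionOn (lrtCylinderOpens false 1) 1 0 v p)
    (hH : HasWeakSpatialGradientOn (lrtCylinderOpens false 1) v H)
    (hE : ∃ M : ℝ≥0, ∀ᵐ t : ℝ, t ∈ Ioo (-1 : ℝ) 0 → ∫⁻ x in lrtBall false 1, ‖v t x‖ₑ ^ 2 ≤ M)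
    (hHfin : ∫⁻ z in lrtCylinder false 1, ENNReal.ofReal (frobeniusNormSq (H z.1 z.2)) < ∞)
    (hp : ∫⁻ z in lrtCylinder false 1, ‖p z.1 z.2‖ₑ ^ (3 / 2 : ℝ) < ∞) :
    IsSuitableWeakSolutionInBall 1 0 v p := by
  have hploc : LocallyIntegrableOn (uncurry p) (lrtCylinder false 1) volume := hsw.distributional.2.2.1
  refine ⟨?_, ?_, ?_, ?_⟩
  · rw [← lrtCylinderOpens_false_eq]; exact hsw
  · obtain ⟨M, hM⟩ := hE
    refine ⟨M, ?_⟩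
    have h1 : Ioo ((0 : ℝ × EuclideanSpace ℝ (Fin 3)).1 - 1 ^ 2) (0 : ℝ × EuclideanSpace ℝ (Fin 3)).1 =
        Ioo (-1 : ℝ) 0 := by simp
    rw [h1, ae_restrict_iff' measurableSet_Ioo]
    filter_upwards [hM] with t ht htI
    simpa using ht htI
  · refine ⟨H, ?_, ?_⟩
    · rw [← lrtCylinderOpens_false_eq]; exact hH
    · rw [← lrtCylinder_false_eq]; exact hHfin
  · rw [← lrtCylinder_false_eq]; exact memLp_of_lintegral hploc hp

/-- The hypotheses of the second rendering (flat case) give the canonical class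
`LeiRen2024.IsSuitableWeakSolutionInCyl 1`. [cite: LeiRenTian2025, §2.1 (2.3)–(2.4) with Remark 2.1 (arXiv p.6)] -/
theorem isSuitableWeakSolutionInCyl_of
    (hsw : IsSuitableWeakSolutionOn (lrtCylinderOpens true 1) 1 0 v p)
    (hH : HasWeakSpatialGradientOn (lrtCylinderOpens true 1) v H)
    (hE : ∃ M : ℝ≥0, ∀ᵐ t : ℝ, t ∈ Ioo (-1 : ℝ) 0 → ∫⁻ x in lrtBall true 1, ‖v t x‖ₑ ^ 2 ≤ M)
    (hHfin : ∫⁻ z in lrtCylinder true 1, ENNReal.ofReal (frobeniusNormSq (H z.1 z.2)) < ∞)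
    (hp : ∫⁻ z in lrtCylinder true 1, ‖p z.1 z.2‖ₑ ^ (3 / 2 : ℝ) < ∞) :
    LeiRen2024.IsSuitableWeakSolutionInCyl 1 v p := by
  have hploc : LocallyIntegrableOn (uncurry p) (lrtCylinder true 1) volume := hsw.distributional.2.2.1
  refine ⟨?_, ?_, ?_, ?_⟩
  · rw [← lrtCylinderOpens_true_eq]; exact hsw
  · obtain ⟨M, hM⟩ := hE
    refine ⟨M, ?_⟩
    have h1 : Ioo (-(1 : ℝ) ^ 2) 0 = Ioo (-1 : ℝ) 0 := by simp
    rw [h1, ae_restrict_iff' measurableSet_Ioo]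
    filter_upwards [hM] with t ht htI
    rw [← lrtBall_true_eq]
    exact ht htI
  · refine ⟨H, ?_, ?_⟩
    · rw [← lrtCylinderOpens_true_eq]; exact hH
    · rw [← lrtCylinder_true_eq]; exact hHfin
  · rw [← lrtCylinder_true_eq]; exact memLp_of_lintegral hploc hp

/-- LRT's `G = ∫_{Q(1)}(|v|³ + |p|^{3/2}) + 2` as a real number bounds the extended integral of the canonical
rendering: `∫ (|v|³ + |p|^{3/2}) + 2 ≤ ofReal G` (the integral being finite). [cite: LeiRenTian2025, §2.1 (arXiv p.6)] -/
theorem lintegral_add_two_le_ofReal_lrtG (cyl : Bool)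
    (hv : AEStronglyMeasurable (uncurry v) (volume.restrict (lrtCylinder cyl 1)))
    (hvfin : ∫⁻ z in lrtCylinder cyl 1, ‖v z.1 z.2‖ₑ ^ (3 : ℝ) < ∞)
    (hpfin : ∫⁻ z in lrtCylinder cyl 1, ‖p z.1 z.2‖ₑ ^ (3 / 2 : ℝ) < ∞) :
    (∫⁻ z in lrtCylinder cyl 1, (‖v z.1 z.2‖ₑ ^ (3 : ℕ) + ‖p z.1 z.2‖ₑ ^ (3 / 2 : ℝ))) + 2 ≤
      ENNReal.ofReal (lrtG cyl v p) := by
  have hmeas : AEMeasurable (fun z : ℝ × EuclideanSpace ℝ (Fin 3) => ‖v z.1 z.2‖ₑ ^ (3 : ℝ))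
      (volume.restrict (lrtCylinder cyl 1)) := (hv.enorm.pow_const _)
  have hsum : ∫⁻ z in lrtCylinder cyl 1, (‖v z.1 z.2‖ₑ ^ (3 : ℝ) + ‖p z.1 z.2‖ₑ ^ (3 / 2 : ℝ)) =
      (∫⁻ z in lrtCylinder cyl 1, ‖v z.1 z.2‖ₑ ^ (3 : ℝ)) +
        ∫⁻ z in lrtCylinder cyl 1, ‖p z.1 z.2‖ₑ ^ (3 / 2 : ℝ) := lintegral_add_left' hmeas _
  have hfin : ∫⁻ z in lrtCylinder cyl 1, (‖v z.1 z.2‖ₑ ^ (3 : ℝ) + ‖p z.1 z.2‖ₑ ^ (3 / 2 : ℝ)) ≠ ∞ := by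
    rw [hsum]; exact (ENNReal.add_lt_top.2 ⟨hvfin, hpfin⟩).ne
  have hnat : ∫⁻ z in lrtCylinder cyl 1, (‖v z.1 z.2‖ₑ ^ (3 : ℕ) + ‖p z.1 z.2‖ₑ ^ (3 / 2 : ℝ)) =
      ∫⁻ z in lrtCylinder cyl 1, (‖v z.1 z.2‖ₑ ^ (3 : ℝ) + ‖p z.1 z.2‖ₑ ^ (3 / 2 : ℝ)) := by
    refine lintegral_congr fun z => ?_
    rw [← ENNReal.rpow_natCast]
    norm_num
  rw [hnat, lrtG, ENNReal.ofReal_add ENNReal.toReal_nonneg (by norm_num), ENNReal.ofReal_toReal hfin]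
  simp

end LeiRenTianBridge

open LeiRenTianBridge in
/-- **The second tree rendering of Lei–Ren–Tian 2025, Lemma 2.4 is a corollary of the canonical one.**
`leiRenTian_quantitative_shells_of_regularity` (`LeiRenQuantitativeShells.lean`, p621411: both cylinder shapes through
a `Bool`, class unpackaged over `lrtCylinderOpens cyl 1` with `∫|v|³ < ∞`, strict bounds `< G^{CG}` with `G = lrtG`, no
regularity clause on the closure) follows from the canonical pair `LeiRen2024_quantitative_regular_shells` (round) and
`LeiRen2024_quantitative_regular_shells_cyl` (flat) (`QuantitativeShellsOfRegularity.lean`, p621185): the cylinders and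
shells coincide as sets, the class repackages into `IsSuitableWeakSolutionInBall 1 0` / `LeiRen2024.IsSuitableWeakSolutionInCyl 1`
(`p ∈ L^{3/2}` from the finite integral plus the local integrability inside `IsSuitableWeakSolutionOn`), one takes the real
`G := lrtG cyl v p` (the integral is finite) and the universal constant `C := max M M' + 1` to turn `≤ G^{MG}` into
`< G^{CG}` and `G^{−MG} < δ` into `G^{−CG} < δ` (`G ≥ 2`), and forgets the closure-regularity clause. Hence the three
recorded `Prop`s for this one printed lemma carry ONE piece of debt (the canonical pair); consumers bind the canonical facts.
[cite: LeiRenTian2025, Lemma 2.4 (arXiv p.7)] [cite: LeiRen2024QuantitativePartialRegularity, Thm 2, Remark 8, Prop 9 (arXiv p.5)] -/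
theorem leiRenTian_quantitative_shells_of_regularity_of_canonical
    (h₁ : LeiRen2024_quantitative_regular_shells) (h₂ : LeiRen2024_quantitative_regular_shells_cyl) :
    leiRenTian_quantitative_shells_of_regularity := by
  obtain ⟨M₁, hM₁, H₁⟩ := h₁
  obtain ⟨M₂, hM₂, H₂⟩ := h₂
  refine ⟨max M₁ M₂ + 1, by positivity, ?_⟩
  intro cyl v p H hsw hH hE hHfin hpfin hvfin
  set G : ℝ := lrtG cyl v p with hG_def
  have hG2 : 2 ≤ G := two_le_lrtG cyl v p
  have hG1 : 1 < G := by linarith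
  have hGpos : 0 < G := by linarith
  have hvmeas : AEStronglyMeasurable (uncurry v) (volume.restrict (lrtCylinder cyl 1)) :=
    (hsw.distributional.1).aestronglyMeasurable
  have hI := lintegral_add_two_le_ofReal_lrtG cyl (p := p) hvmeas hvfin hpfin
  -- exponent bookkeeping: `M G < C G` with `C = max M₁ M₂ + 1`
  have hexp : ∀ {M : ℝ}, M ≤ max M₁ M₂ → ∀ {B δ : ℝ}, B ≤ G ^ (M * G) → G ^ (-(M * G)) < δ →
      B < G ^ ((max M₁ M₂ + 1) * G) ∧ G ^ (-((max M₁ M₂ + 1) * G)) < δ := by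
    intro M hM B δ hB hδ
    have hlt : M * G < (max M₁ M₂ + 1) * G := by
      apply mul_lt_mul_of_pos_right _ hGpos; linarith
    exact ⟨hB.trans_lt (Real.rpow_lt_rpow_of_exponent_lt hG1 hlt),
      (Real.rpow_lt_rpow_of_exponent_lt hG1 (neg_lt_neg hlt)).trans hδ⟩
  cases cyl with
  | false =>
    have hcl := isSuitableWeakSolutionInBall_of hsw hH hE hHfin hpfin
    rw [lrtCylinder_false_eq] at hI
    obtain ⟨a, δ, ha1, ha2, hδ1, hδ2, -, w, hwc, hwd, hwae, hwb⟩ := H₁ v p G hcl hI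
    refine ⟨a, δ, ha1, ha2, (hexp (le_max_left _ _) le_rfl hδ1).2, hδ2, w, ?_, ?_, ?_, ?_⟩
    · rw [lrtShell_false_eq]; exact hwae
    · rw [lrtShell_false_eq]; exact hwc
    · intro t; rw [lrtShell_false_eq]; exact hwd t
    · intro z hz
      rw [lrtShell_false_eq] at hz
      exact (hexp (le_max_left _ _) (hwb z hz) hδ1).1
  | true =>
    have hcl := isSuitableWeakSolutionInCyl_of hsw hH hE hHfin hpfin
    rw [lrtCylinder_true_eq] at hI
    obtain ⟨a, δ, ha1, ha2, hδ1, hδ2, -, w, hwc, hwd, hwae, hwb⟩ := H₂ v p G hcl hI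
    refine ⟨a, δ, ha1, ha2, (hexp (le_max_right _ _) le_rfl hδ1).2, hδ2, w, ?_, ?_, ?_, ?_⟩
    · rw [lrtShell_true_eq]; exact hwae
    · rw [lrtShell_true_eq]; exact hwc
    · intro t; rw [lrtShell_true_eq]; exact hwd t
    · intro z hz
      rw [lrtShell_true_eq] at hz
      exact (hexp (le_max_right _ _) (hwb z hz) hδ1).1

end Literature.Analysis.FluidPDE

end
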